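import Literature.RingTheory.KTheory.MilnorKWittGrothendieckRing
import Literature.RingTheory.KTheory.MilnorKStiefelWhitneyClasses
import Mathlib.RingTheory.PowerSeries.Inverse
import HarnessLib

/-!
# The ring `k_ΠF` of formal series `w₀ + w₁ + w₂ + ⋯` (`wᵢ ∈ kᵢF`) and the Stiefel–Whitney homomorphism
# `w : Ŵ(F) → (k_ΠF)ˣ`, `w((a)) = 1 + l(a)` (Milnor, *Algebraic K-theory and quadratic forms*, Invent. Math. 9 (1970), §3,
# LEMMA 3.1 and «w extends uniquely to a homomorphism from the additive group of ŴF»)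

Family `hodge`, lane `lit-hodgefound` (foundations library; seat `lit-hodgefound-p27`, generation 41, row g41-#2);
topic `RingTheory/KTheory`.  Sequel of `MilnorKWittGrothendieckRing` (g41-#1: `Ŵ(F)`, `gen`, the additive presentation
`liftAdd`), `MilnorKStiefelWhitney` (g40-#14: the ring `k_*F = Mod2Ring F`, `kl a = l(a)`, `kOfDeg`, `sw`),
`MilnorKStarModTwoGraded` (g40-#15: the graded pieces `kRange F n ≅ kₙF`, `kOfDeg_injective`, `gcomponent2`, `kproj`) and
`MilnorKStiefelWhitneyClasses` (g40-#16: `swComp i d = wᵢ`); Mathlib's `PowerSeries`, `PowerSeries.invOfUnit`.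
DEFINITIONS WITH BODIES and PROVED THEOREMS; no named fact, no instance (the commutative ring structure of `k_*F`
is Mathlib's `CommRing` structure on the center `KC F` of `Mod2Ring F`, the ring `k_ΠF` is a `Subring` of
`PowerSeries (KC F)`), no notation, 0 `sorry`, net debt 0 (D-0026).

## The source, verbatim

J. Milnor, *Algebraic K-theory and quadratic forms*, Invent. Math. 9 (1970) 318–344 (held `paper:doi-10-1007-bf01425486`;
bib key `Milnor1970`), §3 (p0010 L34–L36): «The symbol k_ΠF will stand for the algebra consisting of all formal series
w₀ + w₁ + w₂ + ⋯ with wᵢ ∈ kᵢF. Thus k_ΠF is additively isomorphic to the cartesian product k₀F × k₁F × k₂F × ⋯.»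
(p0011 L4–L16): «Define the Stiefel-Whitney invariant w(M) ∈ k_ΠF of a quadratic module M ≅ (a₁) ⊕ ⋯ ⊕ (a_r) by the
formula w(M) = (1 + l(a₁))(1 + l(a₂))⋯(1 + l(a_r)). Thus w(M) can be written as 1 + w₁(M) + ⋯ + w_r(M) where wᵢ(M),
the i-th Stiefel-Whitney invariant, is equal to the i-th elementary symmetric function of l(a₁), …, l(a_r) considered
as an element of kᵢF. Evidently w₁ is just the classical "discriminant" of M, and w₂ is closely related to the
classical Hasse-Witt invariant.»  (p0011 L24–L32): «LEMMA 3.1. The invariant w(M) is a well defined unit in the ring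
k_ΠF and satisfies the Whitney sum formula w(M ⊕ N) = w(M) w(N). *Proof.* Just as in the classical proof that the
Hasse-Witt invariant is well defined, it suffices to consider the rank 2 case. […] Suppose then that (a) ⊕ (b) ≅ (α),
(β). Then the discriminant ab must be equal to αβ multiplied by a square».  (p0012 L24–L28): «Evidently the function w
extends uniquely to a homomorphism from the additive group of ŴF to the multiplicative group of units in k_ΠF; where
w(M − N) = w(M)/w(N) by definition.»

## What is formalised

* **`KC F`**: `k_*F = Mod2Ring F` with Mathlib's commutative ring structure — the center of `Mod2Ring F`, which is all of
  it (`center_eq_top`, from g40's `mul_comm'`; `toKC : Mod2Ring F →+* KC F` bijective); `klc a = l(a)`, `kRangeC n ≅ kₙF`,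
  `kOfDegC n : kₙF →+ KC` injective.
* **`kPi F` = `k_ΠF`**, realised as the subring of the formal power series ring `PowerSeries (KC F)` over
  `k_*F = K_*F/2K_*F` consisting of the series `Σ wᵢXⁱ` with `wᵢ` homogeneous of degree `i` (`wᵢ ∈ kRange F i ≅ kᵢF`):
  the formal series `w₀ + w₁ + w₂ + ⋯` is the power series `Σ wᵢXⁱ` (products match: `(Σ wᵢXⁱ)(Σ vⱼXʲ) = Σ (Σ wᵢvⱼ)Xⁿ`
  with `wᵢvⱼ ∈ k_{i+j}F`, `mul_mem_kRange`); **`kPiEquivPi : k_ΠF ≃+ Π n, kₙF`** («additively isomorphic to the cartesian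
  product k₀F × k₁F × ⋯»); `invOfUnit_mem_kPi` (inverses of units stay in `k_ΠF`).
* **`swUnit F a = 1 + l(a)X ∈ (k_ΠF)ˣ`** and the relations `swUnit (ab²) = swUnit a`,
  **`swUnit a · swUnit b = swUnit c · swUnit (abc)` for `c = λ²a + μ²b`** (`swUnit_mul_swUnit_eq`) — LEMMA 3.1's rank-2
  computation «the discriminant ab must be equal to αβ multiplied by a square […] l(a)l(b) = l(α)l(β)» (from g40's
  `kpair_eq_of_eq_add_sq`).
* **THE STIEFEL–WHITNEY HOMOMORPHISM `swHom F : Ŵ(F) →+ Additive (PowerSeries (KC F))ˣ`** («extends uniquely to a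
  homomorphism from the additive group of ŴF to the multiplicative group of units»), by `liftAdd` of g41-#1, with
  `swSeries F x = w(x)` as a power series: **`swSeries_add : w(x + y) = w(x)w(y)`** (Whitney sum / «w(M − N) = w(M)/w(N)»),
  `swSeries_neg_mul`, **`swSeries_gen : w((a)) = 1 + l(a)X`**, `swSeries_one : w(1) = 1`, `constantCoeff_swSeries = 1`,
  `swHom_unique`.
* **LEMMA 3.1 in `Ŵ(F)`**: for the class `(a₁) + ⋯ + (a_r) ∈ Ŵ(F)` of the diagonal form,
  **`swSeries_list_sum : w = ∏ (1 + l(aᵢ)X)`** («w(M) is a well defined unit»: the class depends only on the isometry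
  class, by the presentation of `Ŵ`), and **`swCoeff_list_sum : coeff i w = wᵢ = swComp F i`** — the coefficients
  are g40's elementary symmetric functions `wᵢ`; **`swSeries_mem_kPi : w(x) ∈ k_ΠF`** for every `x ∈ Ŵ(F)`.
* Not here: Lemma 3.2 / Corollary 3.3 (`w` on `Îⁿ`, row g41-#3), Theorem 4.1 bijectivity (g41-#4); the identification of
  `Ŵ(F)` with isometry classes (cited in g41-#1).

## References

* [Milnor1970] J. Milnor, *Algebraic K-theory and quadratic forms*, Invent. Math. 9 (1970) 318–344 — §3: `k_ΠF`
  (p0010 L34–L36), `w(M)`, `wᵢ` (p0011 L4–L16), Lemma 3.1 (p0011 L24 – p0012 L11), the extension of `w` to `Ŵ`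
  (p0012 L24–L28).
* [Morel2012] F. Morel, *𝔸¹-Algebraic Topology over a Field*, LNM 2052 (2012) — Ch. 3 Lemma 3.9 (the presentation of
  `Ŵ(F)` through which `w` is defined; see `MilnorKWittGrothendieckRing`).

Provenance: lane `lit-hodgefound`, seat `lit-hodgefound-p27` gen 41 (agent `literature-prover-lit-hodgefound-p27-g41-0`),
row g41-#2.
-/

set_option autoImplicit false

noncomputable section

namespace Literature.RingTheory.KTheory

open Function PowerSeries

section Field

variable (F : Type*) [Field F]

namespace MilnorKStar

/-! ### the graded pieces multiply: `kₘF · kₙF ⊆ kₘ₊ₙF` inside `k_*F` -/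

/-- `kOfDeg` is multiplicative for the products `kₘF × kₙF → kₘ₊ₙF` of `MilnorKModTwo`. [cite: Milnor1970, §3 «k_*F is a graded algebra over Z/2Z» (p0010 L30–L31)] -/
theorem kOfDeg_kMul {m n : ℕ} (x : MilnorK.Mod2 F m) (y : MilnorK.Mod2 F n) :
    kOfDeg F (m + n) (MilnorK.kMul F m n x y) = kOfDeg F m x * kOfDeg F n y := by
  obtain ⟨x, rfl⟩ := MilnorK.kmk_surjective x
  obtain ⟨y, rfl⟩ := MilnorK.kmk_surjective y
  rw [MilnorK.kMul_kmk_kmk, kOfDeg_kmk, kOfDeg_kmk, kOfDeg_kmk, ofDeg_mul, map_mul]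

/-- **`kₘF · kₙF ⊆ kₘ₊ₙF`** in `k_*F`. [cite: Milnor1970, §3 «k_*F is a graded algebra over Z/2Z» (p0010 L30–L31)] -/
theorem mul_mem_kRange {m n : ℕ} {x y : Mod2Ring F} (hx : x ∈ kRange F m) (hy : y ∈ kRange F n) :
    x * y ∈ kRange F (m + n) := by
  obtain ⟨x, rfl⟩ := hx
  obtain ⟨y, rfl⟩ := hy
  exact ⟨MilnorK.kMul F m n x y, kOfDeg_kMul F x y⟩

/-- `1 ∈ k₀F`. [cite: Milnor1970, §3 «k_*F is a graded algebra over Z/2Z» (p0010 L30–L31)] -/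
theorem one_mem_kRange_zero : (1 : Mod2Ring F) ∈ kRange F 0 :=
  ⟨MilnorK.kSymbol Fin.elim0, by rw [kOfDeg_kSymbol, List.ofFn_zero, List.prod_nil]⟩

/-- `l(a) ∈ k₁F`. [cite: Milnor1970, §3 «with k₁F ≅ F•/F•²» (p0010 L31)] -/
theorem kl_mem_kRange_one (a : Fˣ) : kl F a ∈ kRange F 1 :=
  ⟨MilnorK.kSymbol fun _ => a, by rw [kOfDeg_kSymbol]; simp⟩

/-! ### the commutative ring `k_*F`: Mathlib's `CommRing` structure on the center, which is everything -/

/-- `k_*F` is commutative (`mul_comm'` of `MilnorKStiefelWhitney`): its center is the whole ring. [cite: Milnor1970, §3 «k_*F is a graded algebra over Z/2Z» (p0010 L30–L31); §1 Lemma 1.1 (p0002 L33–L35)] -/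
theorem center_eq_top : Subring.center (Mod2Ring F) = ⊤ := by
  rw [eq_top_iff]
  rintro z -
  rw [Subring.mem_center_iff]
  exact fun g => mul_comm' F g z

/-- **The ring `k_*F` with its commutative ring structure**: the center of `Mod2Ring F`, which is all of it
(`center_eq_top`) and carries Mathlib's `CommRing` structure (used for products over finite sets and power series
below; no new instance is declared). [cite: Milnor1970, §3 «k_*F is a graded algebra over Z/2Z» (p0010 L30–L31)] -/
abbrev KC : Type _ := ↥(Subring.center (Mod2Ring F))

/-- The identification `k_*F → KC` (the identity map onto the center). [cite: Milnor1970, §3 (p0010 L30–L31)] -/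
def toKC : Mod2Ring F →+* KC F where
  toFun x := ⟨x, by rw [center_eq_top]; trivial⟩
  map_one' := rfl
  map_mul' _ _ := rfl
  map_zero' := rfl
  map_add' _ _ := rfl

/-- `toKC` is the identity on underlying elements. [cite: Milnor1970, §3 (p0010 L30–L31)] -/
theorem coe_toKC (x : Mod2Ring F) : ((toKC F x : KC F) : Mod2Ring F) = x := rfl

/-- `toKC` of an element of the center is itself. [cite: Milnor1970, §3 (p0010 L30–L31)] -/
theorem toKC_coe (x : KC F) : toKC F (x : Mod2Ring F) = x := Subtype.ext rfl

/-- `toKC` is a bijection. [cite: Milnor1970, §3 (p0010 L30–L31)] -/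
theorem toKC_bijective : Function.Bijective (toKC F) :=
  ⟨fun x y h => by rw [← coe_toKC F x, h, coe_toKC], fun y => ⟨y, toKC_coe F y⟩⟩

/-- `2 = 0` in `KC`. [cite: Milnor1970, §3 «k_nF = K_nF/2K_nF» (p0010 L27–L31)] -/
theorem two_eq_zero_KC : (2 : KC F) = 0 := by
  rw [show (2 : KC F) = toKC F 2 from (map_ofNat (toKC F) 2).symm, two_eq_zero, map_zero]

/-- `x + x = 0` in `KC`. [cite: Milnor1970, §3 «k_nF = K_nF/2K_nF» (p0010 L27–L31)] -/
theorem add_self_KC (x : KC F) : x + x = 0 := by rw [← two_mul, two_eq_zero_KC, zero_mul]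

/-- `−x = x` in `KC`. [cite: Milnor1970, §3 «k_nF = K_nF/2K_nF» (p0010 L27–L31)] -/
theorem neg_eq_self_KC (x : KC F) : -x = x := by
  rw [neg_eq_iff_add_eq_zero, add_self_KC]

/-- **`l(a) ∈ k₁F ⊂ k_*F`** in the commutative structure. [cite: Milnor1970, §3 «with k₁F ≅ F•/F•²» (p0010 L31)] -/
def klc (a : Fˣ) : KC F := toKC F (kl F a)

/-- `klc` unfolded. [cite: Milnor1970, §3 (p0010 L31)] -/
theorem klc_def (a : Fˣ) : klc F a = toKC F (kl F a) := rfl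

/-- `l(ab) = l(a) + l(b)`. [cite: Milnor1970, §3 (p0010 L31)] -/
theorem klc_mul (a b : Fˣ) : klc F (a * b) = klc F a + klc F b := by rw [klc_def, kl_mul, map_add]; rfl

/-- `l(1) = 0`. [cite: Milnor1970, §3 (p0010 L31)] -/
theorem klc_one : klc F 1 = 0 := by rw [klc_def, kl_one, map_zero]

/-- `l(ab²) = l(a)`. [cite: Milnor1970, §3 (p0010 L31)] -/
theorem klc_mul_sq (a b : Fˣ) : klc F (a * b ^ 2) = klc F a := by rw [klc_def, kl_mul_sq]; rfl

/-- **`l(a)² = l(a)l(−1)`** (Lemma 1.2 modulo `2`). [cite: Milnor1970, §1 Lemma 1.2 «l(a)² = l(a)l(−1)» (p0002 L36–L37)] -/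
theorem klc_mul_self (a : Fˣ) : klc F a * klc F a = klc F a * klc F (-1) := by
  rw [klc_def, klc_def, ← map_mul, ← map_mul, kl_mul_self]

/-- The Steinberg relation `l(a)l(b) = 0` for `a + b = 1`. [cite: Milnor1970, §1 (p0001 L33 – p0002 L2)] -/
theorem klc_mul_klc_eq_zero {a b : Fˣ} (h : (a : F) + b = 1) : klc F a * klc F b = 0 := by
  rw [klc_def, klc_def, ← map_mul, kl_mul_kl_eq_zero F h, map_zero]

/-- The degree-`n` piece `kₙF` inside `KC`. [cite: Milnor1970, §3 «k_*F is a graded algebra» (p0010 L30–L31)] -/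
def kRangeC (n : ℕ) : AddSubgroup (KC F) := (kRange F n).map (toKC F).toAddMonoidHom

/-- Membership in `kRangeC` is membership of the underlying element in `kRange`. [cite: Milnor1970, §3 (p0010 L30–L31)] -/
theorem mem_kRangeC_iff {n : ℕ} (y : KC F) : y ∈ kRangeC F n ↔ (y : Mod2Ring F) ∈ kRange F n := by
  constructor
  · rintro ⟨x, hx, rfl⟩; exact hx
  · intro h; exact ⟨y, h, toKC_coe F y⟩

/-- `toKC x ∈ kRangeC n ↔ x ∈ kRange n`. [cite: Milnor1970, §3 (p0010 L30–L31)] -/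
theorem toKC_mem_kRangeC_iff {n : ℕ} (x : Mod2Ring F) : toKC F x ∈ kRangeC F n ↔ x ∈ kRange F n := mem_kRangeC_iff F _

/-- `kₘF · kₙF ⊆ kₘ₊ₙF` in `KC`. [cite: Milnor1970, §3 «k_*F is a graded algebra over Z/2Z» (p0010 L30–L31)] -/
theorem mul_mem_kRangeC {m n : ℕ} {x y : KC F} (hx : x ∈ kRangeC F m) (hy : y ∈ kRangeC F n) : x * y ∈ kRangeC F (m + n) := by
  rw [mem_kRangeC_iff] at hx hy ⊢
  exact mul_mem_kRange F hx hy

/-- `1 ∈ k₀F`. [cite: Milnor1970, §3 (p0010 L30–L31)] -/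
theorem one_mem_kRangeC_zero : (1 : KC F) ∈ kRangeC F 0 := (mem_kRangeC_iff F 1).2 (one_mem_kRange_zero F)

/-- `l(a) ∈ k₁F`. [cite: Milnor1970, §3 (p0010 L31)] -/
theorem klc_mem_kRangeC_one (a : Fˣ) : klc F a ∈ kRangeC F 1 := (toKC_mem_kRangeC_iff F _).2 (kl_mem_kRange_one F a)

/-- Powers of a degree-`1` element lie in degree `k`. [cite: Milnor1970, §3 (p0010 L30–L31)] -/
theorem pow_mem_kRangeC {x : KC F} (hx : x ∈ kRangeC F 1) (k : ℕ) : x ^ k ∈ kRangeC F k := by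
  induction k with
  | zero => rw [pow_zero]; exact one_mem_kRangeC_zero F
  | succ k ih => rw [pow_succ]; exact mul_mem_kRangeC F ih hx

/-- A product of `n` degree-`1` elements lies in degree `n`. [cite: Milnor1970, §3 (p0010 L30–L31)] -/
theorem list_prod_mem_kRangeC {n : ℕ} (u : Fin n → KC F) (hu : ∀ i, u i ∈ kRangeC F 1) :
    (List.ofFn u).prod ∈ kRangeC F n := by
  induction n with
  | zero => rw [List.ofFn_zero, List.prod_nil]; exact one_mem_kRangeC_zero F
  | succ n ih =>
    rw [List.ofFn_succ, List.prod_cons]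
    have h := mul_mem_kRangeC F (hu 0) (ih (fun i => u i.succ) fun i => hu i.succ)
    rwa [add_comm] at h

/-- **The graded pieces `kₙF → KC`**, `kOfDeg` followed by `toKC`; injective. [cite: Milnor1970, §3 «k_nF = K_nF/2K_nF. Thus k_*F is a graded algebra» (p0010 L27–L31)] -/
def kOfDegC (n : ℕ) : MilnorK.Mod2 F n →+ KC F := (toKC F).toAddMonoidHom.comp (kOfDeg F n)

/-- `kOfDegC` unfolded. [cite: Milnor1970, §3 (p0010 L27–L31)] -/
theorem kOfDegC_apply {n : ℕ} (x : MilnorK.Mod2 F n) : kOfDegC F n x = toKC F (kOfDeg F n x) := rfl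

/-- `kOfDegC {a₁, …, aₙ} = l(a₁)⋯l(aₙ)`. [cite: Milnor1970, §3 (p0010 L27–L31)] -/
theorem kOfDegC_kSymbol {n : ℕ} (a : Fin n → Fˣ) : kOfDegC F n (MilnorK.kSymbol a) = (List.ofFn fun j => klc F (a j)).prod := by
  rw [kOfDegC_apply, kOfDeg_kSymbol, map_list_prod, List.map_ofFn]; rfl

/-- **`kₙF → KC` is injective** (`kOfDeg_injective`). [cite: Milnor1970, §3 «k_nF = K_nF/2K_nF. Thus k_*F is a graded algebra» (p0010 L27–L31)] -/
theorem kOfDegC_injective (n : ℕ) : Function.Injective (kOfDegC F n) :=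
  (toKC_bijective F).1.comp (kOfDeg_injective F n)

/-- The range of `kOfDegC n` is `kRangeC n`. [cite: Milnor1970, §3 (p0010 L27–L31)] -/
theorem mem_kRangeC_iff_exists {n : ℕ} (y : KC F) : y ∈ kRangeC F n ↔ ∃ x, kOfDegC F n x = y := by
  constructor
  · rintro ⟨_, ⟨x, rfl⟩, rfl⟩; exact ⟨x, rfl⟩
  · rintro ⟨x, rfl⟩; exact ⟨kOfDeg F n x, ⟨x, rfl⟩, rfl⟩

/-! ### the ring `k_ΠF` of formal series `w₀ + w₁ + w₂ + ⋯`, `wᵢ ∈ kᵢF` -/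

/-- **The ring `k_ΠF`**: «the algebra consisting of all formal series w₀ + w₁ + w₂ + ⋯ with wᵢ ∈ kᵢF», realised as the
subring of `PowerSeries KC` (`KC = k_*F` commutative) of the series `Σ wᵢXⁱ` with `wᵢ ∈ kᵢF`. [cite: Milnor1970, §3 (p0010 L34–L36)] -/
def kPi : Subring (PowerSeries (KC F)) where
  carrier := {φ | ∀ n, coeff n φ ∈ kRangeC F n}
  mul_mem' {φ ψ} hφ hψ n := by
    rw [coeff_mul]
    refine AddSubgroup.sum_mem _ fun ij hij => ?_
    rw [Finset.mem_antidiagonal] at hij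
    rw [← hij]
    exact mul_mem_kRangeC F (hφ ij.1) (hψ ij.2)
  one_mem' n := by
    change coeff n (1 : PowerSeries (KC F)) ∈ kRangeC F n
    rw [coeff_one]
    split_ifs with h
    · subst h; exact one_mem_kRangeC_zero F
    · exact zero_mem _
  add_mem' {φ ψ} hφ hψ n := by rw [map_add]; exact add_mem (hφ n) (hψ n)
  zero_mem' n := by
    change coeff n (0 : PowerSeries (KC F)) ∈ kRangeC F n
    rw [map_zero]; exact zero_mem _
  neg_mem' {φ} hφ n := by rw [map_neg]; exact neg_mem (hφ n)

/-- Membership in `k_ΠF`: every coefficient is homogeneous of its degree. [cite: Milnor1970, §3 (p0010 L34–L36)] -/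
theorem mem_kPi_iff (φ : PowerSeries (KC F)) : φ ∈ kPi F ↔ ∀ n, coeff n φ ∈ kRangeC F n := Iff.rfl

/-- `1 + l(a)X ∈ k_ΠF`. [cite: Milnor1970, §3 (p0010 L34–L36), (p0011 L4–L9)] -/
theorem one_add_C_mul_X_mem_kPi (a : Fˣ) : 1 + C (klc F a) * X ∈ kPi F := by
  refine add_mem (Subring.one_mem _) fun n => ?_
  rw [← pow_one X, coeff_C_mul_X_pow]
  split_ifs with h
  · subst h; exact klc_mem_kRangeC_one F a
  · exact zero_mem _

/-- **Inverses stay in `k_ΠF`**: if `φ ∈ k_ΠF` has constant coefficient `1`, so does its inverse series. [cite: Milnor1970, §3 Lemma 3.1 «a well defined unit in the ring k_ΠF» (p0011 L24–L25)] -/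
theorem invOfUnit_mem_kPi {φ : PowerSeries (KC F)} (hφ : φ ∈ kPi F) : invOfUnit φ 1 ∈ kPi F := by
  intro n
  induction n using Nat.strong_induction_on with
  | _ n ih =>
    rw [PowerSeries.coeff_invOfUnit]
    split_ifs with hn
    · subst hn; rw [inv_one, Units.val_one]; exact one_mem_kRangeC_zero F
    · rw [inv_one, Units.val_one, neg_one_mul]
      refine neg_mem (AddSubgroup.sum_mem _ fun ij hij => ?_)
      rw [Finset.mem_antidiagonal] at hij
      split_ifs with h
      · rw [← hij]; exact mul_mem_kRangeC F (hφ ij.1) (ih ij.2 (by omega))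
      · exact zero_mem _

/-- The coefficient of `φ ∈ k_ΠF` in degree `n`, as an element of `kₙF` (through the component `k_*F → kₙF` of
`MilnorKStarModTwoGraded`). [cite: Milnor1970, §3 «additively isomorphic to the cartesian product k₀F × k₁F × k₂F × ⋯» (p0010 L35–L36)] -/
def kPiCoeff (n : ℕ) : ↥(kPi F) →+ MilnorK.Mod2 F n :=
  ((gcomponent2 F n).comp (kproj F)).comp
    ((Subring.center (Mod2Ring F)).subtype.toAddMonoidHom.comp ((coeff n).toAddMonoidHom.comp (kPi F).subtype.toAddMonoidHom))

/-- `kPiCoeff n φ` is the preimage of `coeff n φ` under `kₙF → k_*F`. [cite: Milnor1970, §3 (p0010 L35–L36)] -/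
theorem kOfDegC_kPiCoeff (n : ℕ) (φ : ↥(kPi F)) : kOfDegC F n (kPiCoeff F n φ) = coeff n (φ : PowerSeries (KC F)) := by
  obtain ⟨x, hx⟩ := (mem_kRangeC_iff_exists F _).1 (φ.2 n)
  change toKC F (kOfDeg F n (gcomponent2 F n (kproj F ((coeff n (φ : PowerSeries (KC F)) : KC F) : Mod2Ring F)))) = _
  rw [← hx, kOfDegC_apply, coe_toKC, gcomponent2_kproj_kOfDeg]

/-- The series with prescribed homogeneous coefficients. [cite: Milnor1970, §3 (p0010 L35–L36)] -/
def kPiMk (f : Π n, MilnorK.Mod2 F n) : ↥(kPi F) :=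
  ⟨PowerSeries.mk fun n => kOfDegC F n (f n), fun n => (mem_kRangeC_iff_exists F _).2 ⟨f n, by rw [coeff_mk]⟩⟩

/-- Its coefficients. [cite: Milnor1970, §3 (p0010 L35–L36)] -/
theorem coeff_kPiMk (f : Π n, MilnorK.Mod2 F n) (n : ℕ) : coeff n (kPiMk F f : PowerSeries (KC F)) = kOfDegC F n (f n) := by
  change coeff n (PowerSeries.mk fun n => kOfDegC F n (f n)) = _
  rw [coeff_mk]

/-- **«k_ΠF is additively isomorphic to the cartesian product k₀F × k₁F × k₂F × ⋯».** [cite: Milnor1970, §3 (p0010 L35–L36)] -/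
def kPiEquivPi : ↥(kPi F) ≃+ (Π n, MilnorK.Mod2 F n) where
  toFun φ n := kPiCoeff F n φ
  invFun := kPiMk F
  left_inv φ := by
    refine Subtype.ext (PowerSeries.ext fun n => ?_)
    rw [coeff_kPiMk, kOfDegC_kPiCoeff]
  right_inv f := by
    funext n
    apply kOfDegC_injective F n
    rw [kOfDegC_kPiCoeff, coeff_kPiMk]
  map_add' φ ψ := by funext n; exact map_add _ _ _

/-- `kPiEquivPi` coefficientwise. [cite: Milnor1970, §3 (p0010 L35–L36)] -/
theorem kOfDegC_kPiEquivPi (φ : ↥(kPi F)) (n : ℕ) : kOfDegC F n (kPiEquivPi F φ n) = coeff n (φ : PowerSeries (KC F)) :=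
  kOfDegC_kPiCoeff F n φ

/-! ### `w((a)) = 1 + l(a)` as a unit, and the rank-2 relations (LEMMA 3.1) -/

/-- **`w((a)) = 1 + l(a) ∈ (k_ΠF)ˣ`**, the unit power series `1 + l(a)X` (inverse `1 + l(a)X + l(a)²X² + ⋯`). [cite: Milnor1970, §3 «w(M) = (1 + l(a₁))(1 + l(a₂))⋯(1 + l(a_r))» (p0011 L4–L9); Lemma 3.1 (p0011 L24–L25)] -/
def swUnit (a : Fˣ) : (PowerSeries (KC F))ˣ :=
  Units.mkOfMulEqOne (1 + C (klc F a) * X) (invOfUnit (1 + C (klc F a) * X) 1)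
    (mul_invOfUnit _ _ (by rw [map_add, map_one, map_mul, constantCoeff_C, constantCoeff_X, mul_zero, add_zero, Units.val_one]))

/-- `swUnit a = 1 + l(a)X` as a series. [cite: Milnor1970, §3 (p0011 L4–L9)] -/
theorem coe_swUnit (a : Fˣ) : (swUnit F a : PowerSeries (KC F)) = 1 + C (klc F a) * X := rfl

/-- `w((ab²)) = w((a))`. [cite: Milnor1970, §3 Lemma 3.1 (p0011 L24–L32)] -/
theorem swUnit_mul_sq (a b : Fˣ) : swUnit F (a * b ^ 2) = swUnit F a := Units.ext (by rw [coe_swUnit, coe_swUnit, klc_mul_sq])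

/-- `(1 + l(a)X)(1 + l(b)X) = 1 + (l(a) + l(b))X + l(a)l(b)X²`. [cite: Milnor1970, §3 «Thus w(M) can be written as 1 + w₁(M) + ⋯ + w_r(M)» (p0011 L10–L14)] -/
theorem coe_swUnit_mul_swUnit (a b : Fˣ) : ((swUnit F a * swUnit F b : (PowerSeries (KC F))ˣ) : PowerSeries (KC F)) =
    1 + C (klc F a + klc F b) * X + C (klc F a * klc F b) * X ^ 2 := by
  rw [Units.val_mul, coe_swUnit, coe_swUnit, map_add, map_mul]; ring

/-- **LEMMA 3.1, the rank-2 computation: `w((a))w((b)) = w((c))w((abc))` whenever `c = λ²a + μ²b`** («the discriminant ab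
must be equal to αβ multiplied by a square […] l(a)l(b) = l(α)l(β) mod 2K₂F», β = abα; from `kpair_eq_of_eq_add_sq`).
[cite: Milnor1970, §3 proof of Lemma 3.1, the rank 2 case (p0011 L29 – p0012 L11)] -/
theorem swUnit_mul_swUnit_eq (a b l m c : Fˣ) (h : (c : F) = (l : F) ^ 2 * a + (m : F) ^ 2 * b) :
    swUnit F a * swUnit F b = swUnit F c * swUnit F (a * b * c) := by
  refine Units.ext ?_
  rw [coe_swUnit_mul_swUnit, coe_swUnit_mul_swUnit]
  have h1 : klc F c + klc F (a * b * c) = klc F a + klc F b := by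
    rw [klc_mul, klc_mul, add_comm (klc F c), add_assoc, add_self_KC, add_zero]
  have h2 : klc F c * klc F (a * b * c) = klc F a * klc F b := by
    rw [klc_def, klc_def, klc_def, klc_def, ← map_mul, ← map_mul, ← kOfDeg_swTwo, ← kOfDeg_swTwo, MilnorK.swTwo_def,
      MilnorK.swTwo_def, MilnorK.kpair_eq_of_eq_add_sq a b c l m (by rw [h]; ring)]
  rw [h1, h2]

/-! ### the Stiefel–Whitney homomorphism `w : Ŵ(F) → (k_ΠF)ˣ` -/

/-- **The Stiefel–Whitney homomorphism `w : (Ŵ(F), +) → (k_ΠF)ˣ`, `w((a)) = 1 + l(a)`** («the function w extends uniquely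
to a homomorphism from the additive group of ŴF to the multiplicative group of units in k_ΠF; where w(M − N) = w(M)/w(N)
by definition»), through the additive presentation `liftAdd` of `Ŵ(F)`; values in the units of `PowerSeries KC`
(they lie in `k_ΠF`: `swSeries_mem_kPi`). [cite: Milnor1970, §3 (p0012 L24–L28); Lemma 3.1 (p0011 L24–L25)] -/
def swHom : WittGrothendieckRing F →+ Additive (PowerSeries (KC F))ˣ :=
  WittGrothendieckRing.liftAdd F (fun a => Additive.ofMul (swUnit F a)) (fun a b => by rw [swUnit_mul_sq])
    (fun a b l m c h => by rw [← ofMul_mul, ← ofMul_mul, swUnit_mul_swUnit_eq F a b l m c h])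

/-- `w((a)) = 1 + l(a)`. [cite: Milnor1970, §3 (p0011 L4–L9), (p0012 L24–L28)] -/
theorem swHom_gen (a : Fˣ) : swHom F (WittGrothendieckRing.gen F a) = Additive.ofMul (swUnit F a) := by
  rw [swHom, WittGrothendieckRing.liftAdd_gen]

/-- **«extends uniquely»**: an additive `Ŵ(F) → (k_ΠF)ˣ` with `(a) ↦ 1 + l(a)` is `w`. [cite: Milnor1970, §3 (p0012 L24–L26)] -/
theorem swHom_unique (f : WittGrothendieckRing F →+ Additive (PowerSeries (KC F))ˣ)
    (hf : ∀ a, f (WittGrothendieckRing.gen F a) = Additive.ofMul (swUnit F a)) : f = swHom F :=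
  WittGrothendieckRing.addMonoidHom_ext F (f := f) (f' := swHom F) fun a => by rw [hf, swHom_gen]

/-- **`w(x) ∈ k_ΠF` as a power series** (the underlying series of the unit `swHom x`). [cite: Milnor1970, §3 (p0012 L24–L28)] -/
def swSeries (x : WittGrothendieckRing F) : PowerSeries (KC F) :=
  ((Additive.toMul (swHom F x) : (PowerSeries (KC F))ˣ) : PowerSeries (KC F))

/-- `swSeries` unfolded. [cite: Milnor1970, §3 (p0012 L24–L28)] -/
theorem swSeries_def (x : WittGrothendieckRing F) :
    swSeries F x = ((Additive.toMul (swHom F x) : (PowerSeries (KC F))ˣ) : PowerSeries (KC F)) := rfl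

/-- **The Whitney sum formula / additivity: `w(x + y) = w(x)w(y)`.** [cite: Milnor1970, §3 Lemma 3.1 «w(M ⊕ N) = w(M)w(N)» (p0011 L24–L27); (p0012 L24–L28)] -/
theorem swSeries_add (x y : WittGrothendieckRing F) : swSeries F (x + y) = swSeries F x * swSeries F y := by
  rw [swSeries_def, map_add, toMul_add, Units.val_mul, ← swSeries_def, ← swSeries_def]

/-- `w(0) = 1`. [cite: Milnor1970, §3 (p0012 L24–L28)] -/
theorem swSeries_zero : swSeries F 0 = 1 := by rw [swSeries_def, map_zero, toMul_zero, Units.val_one]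

/-- **`w(−x)w(x) = 1`: «w(M − N) = w(M)/w(N)».** [cite: Milnor1970, §3 (p0012 L27–L28)] -/
theorem swSeries_neg_mul (x : WittGrothendieckRing F) : swSeries F (-x) * swSeries F x = 1 := by
  rw [← swSeries_add, neg_add_cancel, swSeries_zero]

/-- `w(x − y)w(y) = w(x)`. [cite: Milnor1970, §3 «w(M − N) = w(M)/w(N)» (p0012 L27–L28)] -/
theorem swSeries_sub_mul (x y : WittGrothendieckRing F) : swSeries F (x - y) * swSeries F y = swSeries F x := by
  rw [← swSeries_add, sub_add_cancel]

/-- `w(x)` is a unit. [cite: Milnor1970, §3 Lemma 3.1 «a well defined unit» (p0011 L24–L25)] -/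
theorem isUnit_swSeries (x : WittGrothendieckRing F) : IsUnit (swSeries F x) := Units.isUnit _

/-- Sums go to products. [cite: Milnor1970, §3 Lemma 3.1 «w(M ⊕ N) = w(M)w(N)» (p0011 L24–L27)] -/
theorem swSeries_list_sum' (l : List (WittGrothendieckRing F)) : swSeries F l.sum = (l.map (swSeries F)).prod := by
  induction l with
  | nil => rw [List.sum_nil, List.map_nil, List.prod_nil, swSeries_zero]
  | cons x l ih => rw [List.sum_cons, List.map_cons, List.prod_cons, swSeries_add, ih]

/-- Finite sums go to finite products. [cite: Milnor1970, §3 Lemma 3.1 «w(M ⊕ N) = w(M)w(N)» (p0011 L24–L27)] -/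
theorem swSeries_sum {ι : Type*} (s : Finset ι) (x : ι → WittGrothendieckRing F) :
    swSeries F (∑ i ∈ s, x i) = ∏ i ∈ s, swSeries F (x i) := by
  classical
  induction s using Finset.induction_on with
  | empty => rw [Finset.sum_empty, Finset.prod_empty, swSeries_zero]
  | insert i s hi ih => rw [Finset.sum_insert hi, Finset.prod_insert hi, swSeries_add, ih]

/-- Integer multiples go to powers: `w(n·x) = w(x)ⁿ`. [cite: Milnor1970, §3 (p0012 L24–L28)] -/
theorem swSeries_zsmul (n : ℤ) (x : WittGrothendieckRing F) :
    swSeries F (n • x) = ((Additive.toMul (swHom F x) ^ n : (PowerSeries (KC F))ˣ) : PowerSeries (KC F)) := by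
  rw [swSeries_def, map_zsmul, toMul_zsmul]

/-- **`w((a)) = 1 + l(a)X`.** [cite: Milnor1970, §3 «w(M) = (1 + l(a₁))(1 + l(a₂))⋯(1 + l(a_r))» (p0011 L4–L9)] -/
theorem swSeries_gen (a : Fˣ) : swSeries F (WittGrothendieckRing.gen F a) = 1 + C (klc F a) * X := by
  rw [swSeries_def, swHom_gen, toMul_ofMul, coe_swUnit]

/-- `w(1) = w((1)) = 1 + l(1) = 1`. [cite: Milnor1970, §3 (p0011 L4–L9)] -/
theorem swSeries_one : swSeries F 1 = 1 := by
  rw [← WittGrothendieckRing.gen_one, swSeries_gen, klc_one, map_zero, zero_mul, add_zero]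

/-- `w` of an integer is `1`. [cite: Milnor1970, §3 (p0011 L4–L9)] -/
theorem swSeries_intCast (n : ℤ) : swSeries F (n : WittGrothendieckRing F) = 1 := by
  have h : (n : WittGrothendieckRing F) = n • (1 : WittGrothendieckRing F) := by rw [zsmul_eq_mul, mul_one]
  rw [h, swSeries_zsmul]
  have h1 : Additive.toMul (swHom F 1) = 1 := Units.ext (by rw [Units.val_one, ← swSeries_one F, swSeries_def])
  rw [h1, one_zpow, Units.val_one]

/-- **The constant term of `w(x)` is `1`** (`w(x) = 1 + w₁ + w₂ + ⋯`). [cite: Milnor1970, §3 «Thus w(M) can be written as 1 + w₁(M) + ⋯» (p0011 L10–L11)] -/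
theorem constantCoeff_swSeries (x : WittGrothendieckRing F) : constantCoeff (swSeries F x) = 1 := by
  have hx : x ∈ AddSubgroup.closure (Set.range (WittGrothendieckRing.gen F)) := by
    rw [WittGrothendieckRing.closure_range_gen]; trivial
  induction hx using AddSubgroup.closure_induction with
  | mem y hy =>
    obtain ⟨a, rfl⟩ := hy
    rw [swSeries_gen, map_add, map_one, map_mul, constantCoeff_C, constantCoeff_X, mul_zero, add_zero]
  | zero => rw [swSeries_zero, map_one]
  | add y z _ _ hy hz => rw [swSeries_add, map_mul, hy, hz, mul_one]
  | neg y _ hy =>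
    have h := congr_arg constantCoeff (swSeries_neg_mul F y)
    rw [map_mul, hy, mul_one, map_one] at h
    exact h

/-- `coeff 0 (w x) = 1`. [cite: Milnor1970, §3 (p0011 L10–L11)] -/
theorem coeff_zero_swSeries (x : WittGrothendieckRing F) : coeff 0 (swSeries F x) = 1 := by
  rw [coeff_zero_eq_constantCoeff_apply, constantCoeff_swSeries]

/-- The inverse of the unit `w(x)` is the inverse series `invOfUnit (w x) 1`. [cite: Milnor1970, §3 Lemma 3.1 «a well defined unit in the ring k_ΠF» (p0011 L24–L25)] -/
theorem swSeries_neg (x : WittGrothendieckRing F) : swSeries F (-x) = invOfUnit (swSeries F x) 1 := by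
  have h1 := swSeries_neg_mul F x
  have h2 : swSeries F x * invOfUnit (swSeries F x) 1 = 1 :=
    mul_invOfUnit _ _ (by rw [constantCoeff_swSeries, Units.val_one])
  calc swSeries F (-x) = swSeries F (-x) * (swSeries F x * invOfUnit (swSeries F x) 1) := by rw [h2, mul_one]
    _ = invOfUnit (swSeries F x) 1 := by rw [← mul_assoc, h1, one_mul]

/-- **`w(x) ∈ k_ΠF` for every `x ∈ Ŵ(F)`**: all the coefficients `wᵢ(x)` are homogeneous of degree `i` («wᵢ […]
considered as an element of kᵢF»; LEMMA 3.1 «a well defined unit in the ring k_ΠF»). [cite: Milnor1970, §3 (p0011 L10–L14), Lemma 3.1 (p0011 L24–L25), (p0012 L24–L28)] -/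
theorem swSeries_mem_kPi (x : WittGrothendieckRing F) : swSeries F x ∈ kPi F := by
  have hx : x ∈ AddSubgroup.closure (Set.range (WittGrothendieckRing.gen F)) := by
    rw [WittGrothendieckRing.closure_range_gen]; trivial
  induction hx using AddSubgroup.closure_induction with
  | mem y hy => obtain ⟨a, rfl⟩ := hy; rw [swSeries_gen]; exact one_add_C_mul_X_mem_kPi F a
  | zero => rw [swSeries_zero]; exact Subring.one_mem _
  | add y z _ _ hy hz => rw [swSeries_add]; exact Subring.mul_mem _ hy hz
  | neg y _ hy => rw [swSeries_neg]; exact invOfUnit_mem_kPi F hy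

/-- **The `i`-th Stiefel–Whitney invariant `wᵢ(x) ∈ kᵢF ⊂ k_*F` of `x ∈ Ŵ(F)`**: the degree-`i` coefficient of `w(x)`. [cite: Milnor1970, §3 «wᵢ(M), the i-th Stiefel-Whitney invariant» (p0011 L10–L14)] -/
def swCoeff (i : ℕ) (x : WittGrothendieckRing F) : KC F := coeff i (swSeries F x)

/-- `swCoeff` unfolded. [cite: Milnor1970, §3 (p0011 L10–L14)] -/
theorem swCoeff_def (i : ℕ) (x : WittGrothendieckRing F) : swCoeff F i x = coeff i (swSeries F x) := rfl

/-- `w₀ = 1`. [cite: Milnor1970, §3 (p0011 L10–L11)] -/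
theorem swCoeff_zero (x : WittGrothendieckRing F) : swCoeff F 0 x = 1 := coeff_zero_swSeries F x

/-- **`wᵢ(x) ∈ kᵢF`.** [cite: Milnor1970, §3 «considered as an element of kᵢF» (p0011 L12–L14)] -/
theorem swCoeff_mem_kRangeC (i : ℕ) (x : WittGrothendieckRing F) : swCoeff F i x ∈ kRangeC F i := swSeries_mem_kPi F x i

/-- `w₁((a)) = l(a)` («Evidently w₁ is just the classical "discriminant"»). [cite: Milnor1970, §3 (p0011 L15–L16)] -/
theorem swCoeff_one_gen (a : Fˣ) : swCoeff F 1 (WittGrothendieckRing.gen F a) = klc F a := by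
  rw [swCoeff_def, swSeries_gen, map_add, coeff_one, if_neg one_ne_zero, ← pow_one X, coeff_C_mul_X_pow, if_pos rfl,
    zero_add]

/-- `wᵢ((a)) = 0` for `i ≥ 2`. [cite: Milnor1970, §3 «For i > r the definition implies that wᵢ(M) = 0» (p0011 L12)] -/
theorem swCoeff_gen_of_two_le {i : ℕ} (hi : 2 ≤ i) (a : Fˣ) : swCoeff F i (WittGrothendieckRing.gen F a) = 0 := by
  rw [swCoeff_def, swSeries_gen, map_add, coeff_one, if_neg (by omega), ← pow_one X, coeff_C_mul_X_pow, if_neg (by omega),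
    zero_add]

/-! ### LEMMA 3.1 in `Ŵ(F)`: `w` of the class of a diagonal form -/

/-- **LEMMA 3.1: `w((a₁) + ⋯ + (a_r)) = (1 + l(a₁)X)⋯(1 + l(a_r)X)`** — the Stiefel–Whitney invariant of the class in
`Ŵ(F)` of the diagonal form `⟨a₁, …, a_r⟩` («w(M) is a well defined unit»: two diagonalizations of isometric modules have
the same class in `Ŵ(F)`, so the same `w`). [cite: Milnor1970, §3 Lemma 3.1 (p0011 L24–L29); «w(M) = (1 + l(a₁))⋯(1 + l(a_r))» (p0011 L4–L9)] -/
theorem swSeries_list_sum (d : List Fˣ) :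
    swSeries F (d.map (WittGrothendieckRing.gen F)).sum = (d.map fun a => 1 + C (klc F a) * X).prod := by
  rw [swSeries_list_sum', List.map_map]
  congr 1
  exact List.map_congr_left fun a _ => swSeries_gen F a

/-- The recursion of the coefficients of `(1 + cX)·φ`: `coeff (i+1) ((1 + cX)φ) = coeff (i+1) φ + c·coeff i φ`. [cite: Milnor1970, §3 «the i-th elementary symmetric function» (p0011 L10–L14)] -/
theorem coeff_succ_one_add_C_mul_X_mul (c : KC F) (φ : PowerSeries (KC F)) (i : ℕ) :
    coeff (i + 1) ((1 + C c * X) * φ) = coeff (i + 1) φ + c * coeff i φ := by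
  rw [add_mul, one_mul, map_add, mul_assoc, coeff_C_mul, coeff_succ_X_mul]

/-- `coeff 0 ((1 + cX)φ) = coeff 0 φ`. [cite: Milnor1970, §3 (p0011 L10–L14)] -/
theorem coeff_zero_one_add_C_mul_X_mul (c : KC F) (φ : PowerSeries (KC F)) :
    coeff 0 ((1 + C c * X) * φ) = coeff 0 φ := by
  rw [add_mul, one_mul, map_add, mul_assoc, coeff_C_mul, coeff_zero_eq_constantCoeff_apply (X * φ), map_mul,
    constantCoeff_X, zero_mul, mul_zero, add_zero]

/-- **The coefficients of `w(⟨a₁, …, a_r⟩)` are the elementary symmetric functions `wᵢ = swComp F i` of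
`MilnorKStiefelWhitneyClasses`** («wᵢ(M), the i-th Stiefel-Whitney invariant, is equal to the i-th elementary symmetric
function of l(a₁), …, l(a_r)»). [cite: Milnor1970, §3 (p0011 L10–L14)] -/
theorem coeff_prod_one_add_C_mul_X (d : List Fˣ) (i : ℕ) :
    coeff i (d.map fun a => 1 + C (klc F a) * X).prod = toKC F (swComp F i d) := by
  induction d generalizing i with
  | nil =>
    rw [List.map_nil, List.prod_nil, coeff_one]
    cases i with
    | zero => rw [if_pos rfl, swComp_zero, map_one]
    | succ i => rw [if_neg (Nat.succ_ne_zero i), swComp_succ_nil, map_zero]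
  | cons a d ih =>
    rw [List.map_cons, List.prod_cons]
    cases i with
    | zero => rw [coeff_zero_one_add_C_mul_X_mul, ih, swComp_zero, swComp_zero]
    | succ i => rw [coeff_succ_one_add_C_mul_X_mul, ih, ih, swComp_succ_cons, map_add, map_mul, klc_def]

/-- **`wᵢ((a₁) + ⋯ + (a_r)) = swComp F i ⟨a₁, …, a_r⟩`**: the Stiefel–Whitney invariants of §3 on the class of a diagonal
form are g40's `wᵢ`. [cite: Milnor1970, §3 (p0011 L10–L14), Lemma 3.1 (p0011 L24–L29)] -/
theorem swCoeff_list_sum (i : ℕ) (d : List Fˣ) :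
    swCoeff F i (d.map (WittGrothendieckRing.gen F)).sum = toKC F (swComp F i d) := by
  rw [swCoeff_def, swSeries_list_sum, coeff_prod_one_add_C_mul_X]

/-- `wᵢ = 0` above the rank («For i > r the definition implies that wᵢ(M) = 0»). [cite: Milnor1970, §3 (p0011 L12)] -/
theorem swCoeff_list_sum_of_length_lt {i : ℕ} {d : List Fˣ} (h : d.length < i) :
    swCoeff F i (d.map (WittGrothendieckRing.gen F)).sum = 0 := by
  rw [swCoeff_list_sum, swComp_of_length_lt F h, map_zero]

/-- Consistency with g40's `sw F d = ∏(1 + l(aᵢ)) ∈ k_*F`: the sum of all the coefficients of `w(⟨a₁, …, a_r⟩)` is `sw F d`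
(«w(M) = 1 + w₁(M) + ⋯ + w_r(M)»). [cite: Milnor1970, §3 (p0011 L10–L11)] -/
theorem sum_swCoeff_list_sum (d : List Fˣ) :
    ∑ i ∈ Finset.range (d.length + 1), swCoeff F i (d.map (WittGrothendieckRing.gen F)).sum = toKC F (sw F d) := by
  rw [sw_eq_sum_swComp, map_sum]
  exact Finset.sum_congr rfl fun i _ => swCoeff_list_sum F i d

end MilnorKStar

end Field

end Literature.RingTheory.KTheory

end
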